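import Literature.NumberTheory.LFunctions.Zhang2022.SkeletonPartTwo
import Literature.NumberTheory.Sieve.DivisorBound
import HarnessLib

/-!
# Zhang (2022), Lemma 8.4 — I: the coefficients `χ(n)ξ₀ⱼ(n;d,r)n^{β_μ−1}` and their Dirichlet series

Topic `Literature/NumberTheory/LFunctions/Zhang2022` (Landau–Siegel audit tree; verdict-neutral).
Y. Zhang, *Discrete mean estimates and the Landau–Siegel zero*, arXiv:2211.02515v1 (2022)
[Zhang2022LandauSiegel] — **an unrefereed manuscript under adjudication**; DAG nodes `Z22:Lem8.4`,
`Z22:Lem8.4.pf`, `Z22:(8.9)` [Z22 p.46–47, Lemma 8.4 and (8.9), tex L2392–2418].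

The proof of Lemma 8.4 starts from the Perron integral (8.9)
`∑_{n<x} χ(n)ξ₀ⱼ(n;d,r)n⁻¹(x/n)^{−β_μ}log(x/n) = (2πi)⁻¹∫_{(1)} (∑_n χ(n)ξ₀ⱼ(n;d,r)n^{−(1+s)}) x^s ds/(s+β_μ)²`.
To write it in the kernel one needs the ABSOLUTE CONVERGENCE of the Dirichlet series
`∑_n χ(n)ξ₀ⱼ(n;d,r)n^{−s}` in some right half-plane, i.e. a polynomial bound for the manuscript's
coefficients `ξ₀ⱼ(n;d,r) = λ̃₀ⱼ(n,dr)∑_{n=d₁k,(k,r)=1} κ̃₀ⱼ(d₁;drk)μ(k)k^{1−β_j}/φ(k)` (§7 p.13), which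
the manuscript never states. This file PROVES it for the skeleton's objects
(`Skeleton.kappaZ`, `kappaTilde`, `lam`, `lamZero`, `lamTildeZero`, `kappaTildeZero`, `xiZero` of
`SkeletonMeanValue`), elementary throughout:

* `betaJ_eq`, `betaMu_eq`: the shifts are purely imaginary, `β_j = i b_j`, `β_μ = i b_μ`;
* `norm_lamZero_prime_le`: `|λ₀ⱼ(q)| ≤ 27/4` (`q` prime); `norm_lamTildeZero_le`: `|λ̃₀ⱼ(n,dr)| ≤ n³`;
* `norm_kappaZ_le`: `|κ(N)| ≤ τ(N)³` (`κ` multiplicative, `|κ(p^k)| ≤ (k+1)³`,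
  `Section7MeanSquareMajorant`), hence `|κ(N)| ≤ C_τ³ N^{1/2}` by the divisor bound
  (`Literature.NumberTheory.Sieve.exists_card_divisors_le_mul_rpow`, Hardy–Wright Thm 315);
* `norm_kappaTilde_le`: `|κ̃(d;m,s)| ≤ C_τ³ d³` for `Re s = 1` (majorant `C_τ³ d^{1/2} h^{−1/2}` on the
  `d`-factored numbers `𝔫(d)`, summed by the Euler product
  `EulerProduct.summable_and_hasSum_factoredNumbers_prod_filter_prime_geometric`);
* `norm_xiZero_le`: `|ξ₀ⱼ(n;d,r)| ≤ C_τ³ n⁸`;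
* `norm_coeff_le`, `LSeriesSummable_coeff` (`Re u > 8`), `LSeries_coeff_eq_xiSeries`:
  `∑_n χ(n)ξ₀ⱼ(n;d,r)n^{β_μ−1}n^{−u} = xiSeries(1 − β_μ + u)`;
* `summand_eq`, `sum_Ico_eq_sum_Ioc`: the printed summand is `x^{−β_μ}·coeff(n)·log(x/n)`.

Nothing about the manuscript's Theorems 1–2 or about Landau–Siegel zeros is asserted.

## References

* Y. Zhang, arXiv:2211.02515v1 (2022), §7 p.13 (`κ, κ̃, λ, ξ₀ⱼ`), §8 Lemma 8.4, (8.9).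
  [cite: Zhang2022LandauSiegel, §7 p.13; §8 Lemma 8.4, (8.9)]
* G. H. Hardy, E. M. Wright, *An Introduction to the Theory of Numbers*, Thm 315.
  [cite: HardyWright2008, Theorem 315]
-/

noncomputable section

open Complex Real Finset Filter

namespace Literature.NumberTheory.LFunctions.Zhang2022.Lemma84

open Skeleton MeanSquareMajorant

/-! ### The shifts `β_j`, `β_μ` are purely imaginary -/

section Shifts

variable (c' : ℝ) (D : ℕ)

/-- `β_j = i b_j` with `b_j ∈ {b₁, b₂, b₃}` real (index convention `β₄ = β₁, β₅ = β₂` of §8).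
[cite: Zhang2022LandauSiegel, §2 (2.13), §8 p.17] -/
theorem betaJ_eq (j : ℕ) : betaJ c' D j =
    ((if j % 3 = 1 then b1 c' D else if j % 3 = 2 then b2 c' D else b3 c' D : ℝ) : ℂ) * I := by
  unfold betaJ
  split_ifs <;> simp only [beta1, beta2, beta3, b1, b2, b3] <;> push_cast <;> ring

/-- `Re β_j = 0`. [cite: Zhang2022LandauSiegel, §2 (2.13)] -/
theorem betaJ_re (j : ℕ) : (betaJ c' D j).re = 0 := by
  rw [betaJ_eq]; simp

/-- `Re β₁ = 0`. [cite: Zhang2022LandauSiegel, §2 (2.13)] -/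
theorem beta1_re : (beta1 c' D).re = 0 := by
  have h := betaJ_re c' D 1
  simpa [betaJ] using h

/-- `Re β₂ = 0`. [cite: Zhang2022LandauSiegel, §2 (2.13)] -/
theorem beta2_re : (beta2 c' D).re = 0 := by
  have h := betaJ_re c' D 2
  simpa [betaJ] using h

/-- `Re β₃ = 0`. [cite: Zhang2022LandauSiegel, §2 (2.13)] -/
theorem beta3_re : (beta3 c' D).re = 0 := by
  have h := betaJ_re c' D 3
  simpa [betaJ] using h

/-- `‖β_j‖ ≤ 3α(1 + 5|c′|α𝓛)` (for `α, 𝓛 ≥ 0`). [cite: Zhang2022LandauSiegel, §2 (2.13)] -/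
theorem norm_betaJ_le (j : ℕ) (hα : 0 ≤ alpha D) (hℓ : 0 ≤ ell D) :
    ‖betaJ c' D j‖ ≤ 3 * alpha D * (1 + 5 * |c'| * alpha D * ell D) := by
  rw [betaJ_eq, norm_mul, Complex.norm_I, mul_one, Complex.norm_real, Real.norm_eq_abs]
  have h5 : |5 * c' * alpha D * ell D| = 5 * |c'| * alpha D * ell D := by
    rw [abs_mul, abs_mul, abs_mul, abs_of_nonneg hα, abs_of_nonneg hℓ]
    norm_num
  have hc : |c' * alpha D * ell D| = |c'| * alpha D * ell D := by
    rw [abs_mul, abs_mul, abs_of_nonneg hα, abs_of_nonneg hℓ]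
  have hpos : 0 ≤ |c'| * alpha D * ell D := by positivity
  split_ifs
  · rw [b1, abs_mul, abs_of_nonneg hα]
    have : |1 - 5 * c' * alpha D * ell D| ≤ 1 + 5 * |c'| * alpha D * ell D := by
      calc |1 - 5 * c' * alpha D * ell D| ≤ |(1 : ℝ)| + |5 * c' * alpha D * ell D| := abs_sub _ _
        _ = 1 + 5 * |c'| * alpha D * ell D := by rw [abs_one, h5]
    nlinarith
  · rw [b2, abs_mul, abs_mul, abs_of_nonneg hα, show |(2 : ℝ)| = 2 by norm_num]
    have : |1 + c' * alpha D * ell D| ≤ 1 + |c'| * alpha D * ell D := by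
      calc |1 + c' * alpha D * ell D| ≤ |(1 : ℝ)| + |c' * alpha D * ell D| := abs_add_le _ _
        _ = 1 + |c'| * alpha D * ell D := by rw [abs_one, hc]
    nlinarith
  · rw [b3, abs_mul, abs_mul, abs_of_nonneg hα, show |(3 : ℝ)| = 3 by norm_num]
    have : |1 - c' * alpha D * ell D| ≤ 1 + |c'| * alpha D * ell D := by
      calc |1 - c' * alpha D * ell D| ≤ |(1 : ℝ)| + |c' * alpha D * ell D| := abs_sub _ _
        _ = 1 + |c'| * alpha D * ell D := by rw [abs_one, hc]
    nlinarith

/-- `β_μ = i b_μ` with `b₆ = 3α/2`, `b₇ = 5α/2` ((2.22); any index other than `7` is sent to `β₆`,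
as in `Skeleton.betaMu`). [cite: Zhang2022LandauSiegel, §2 (2.22)] -/
theorem betaMu_eq (μ : ℕ) :
    betaMu D μ = ((if μ = 7 then 5 * alpha D / 2 else 3 * alpha D / 2 : ℝ) : ℂ) * I := by
  unfold betaMu
  split_ifs <;> simp only [beta6, beta7] <;> push_cast <;> ring

/-- `Re β_μ = 0`. [cite: Zhang2022LandauSiegel, §2 (2.22)] -/
theorem betaMu_re (μ : ℕ) : (betaMu D μ).re = 0 := by
  rw [betaMu_eq]; simp

/-- `Im β_μ ∈ {3α/2, 5α/2}`. [cite: Zhang2022LandauSiegel, §2 (2.22)] -/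
theorem betaMu_im (μ : ℕ) :
    (betaMu D μ).im = if μ = 7 then 5 * alpha D / 2 else 3 * alpha D / 2 := by
  rw [betaMu_eq]; simp

/-- `3α/2 ≤ Im β_μ ≤ 5α/2` (for `α ≥ 0`). [cite: Zhang2022LandauSiegel, §2 (2.22)] -/
theorem betaMu_im_bounds (μ : ℕ) (hα : 0 ≤ alpha D) :
    3 * alpha D / 2 ≤ (betaMu D μ).im ∧ (betaMu D μ).im ≤ 5 * alpha D / 2 := by
  rw [betaMu_im]; split_ifs <;> constructor <;> linarith

/-- `‖β_μ‖ = Im β_μ` (for `α ≥ 0`). [cite: Zhang2022LandauSiegel, §2 (2.22)] -/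
theorem norm_betaMu (μ : ℕ) (hα : 0 ≤ alpha D) : ‖betaMu D μ‖ = (betaMu D μ).im := by
  have him := (betaMu_im_bounds D μ hα).1
  rw [betaMu_im] at him ⊢
  rw [betaMu_eq, norm_mul, Complex.norm_I, mul_one, Complex.norm_real, Real.norm_eq_abs,
    abs_of_nonneg (by linarith)]

end Shifts

/-! ### `λ₀ⱼ` and `λ̃₀ⱼ` -/

section Lambda

variable (c' : ℝ) (D : ℕ)

/-- `‖q^{−z}‖ = q⁻¹` for `Re z = 1`, `q ≥ 1`. [folklore] -/
private theorem norm_natCast_cpow_neg_of_re_eq_one {q : ℕ} (hq : 0 < q) {z : ℂ} (hz : z.re = 1) :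
    ‖(q : ℂ) ^ (-z)‖ = (q : ℝ)⁻¹ := by
  rw [Complex.norm_natCast_cpow_of_pos hq, neg_re, hz, Real.rpow_neg_one]

/-- `‖1 − q^{−z}‖ ≤ 3/2` for `q ≥ 2`, `Re z = 1`. [folklore] -/
private theorem norm_one_sub_cpow_le {q : ℕ} (hq : 2 ≤ q) {z : ℂ} (hz : z.re = 1) :
    ‖1 - (q : ℂ) ^ (-z)‖ ≤ 3 / 2 := by
  have hq0 : 0 < q := by omega
  have hqinv : (q : ℝ)⁻¹ ≤ 1 / 2 := by
    rw [inv_eq_one_div]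
    exact one_div_le_one_div_of_le (by norm_num) (by exact_mod_cast hq)
  calc ‖1 - (q : ℂ) ^ (-z)‖ ≤ ‖(1 : ℂ)‖ + ‖(q : ℂ) ^ (-z)‖ := norm_sub_le _ _
    _ = 1 + (q : ℝ)⁻¹ := by rw [norm_one, norm_natCast_cpow_neg_of_re_eq_one hq0 hz]
    _ ≤ 3 / 2 := by linarith

/-- `‖1 − q^{−z}‖ ≥ 1/2` for `q ≥ 2`, `Re z = 1`. [folklore] -/
private theorem half_le_norm_one_sub_cpow {q : ℕ} (hq : 2 ≤ q) {z : ℂ} (hz : z.re = 1) :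
    1 / 2 ≤ ‖1 - (q : ℂ) ^ (-z)‖ := by
  have hq0 : 0 < q := by omega
  have hqinv : (q : ℝ)⁻¹ ≤ 1 / 2 := by
    rw [inv_eq_one_div]
    exact one_div_le_one_div_of_le (by norm_num) (by exact_mod_cast hq)
  have h := norm_sub_norm_le (1 : ℂ) ((q : ℂ) ^ (-z))
  rw [norm_one, norm_natCast_cpow_neg_of_re_eq_one hq0 hz] at h
  linarith

/-- `λ(q,s)` at a prime `q` is the single Euler factor. [cite: Zhang2022LandauSiegel, §7 p.13] -/
theorem lam_prime {q : ℕ} (hq : q.Prime) (s : ℂ) :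
    lam c' D q s = (1 - (q : ℂ) ^ (-(s + beta1 c' D))) * (1 - (q : ℂ) ^ (-(s + beta2 c' D))) *
      (1 - (q : ℂ) ^ (-(s + beta3 c' D))) / (1 - (q : ℂ) ^ (-s)) := by
  rw [lam, hq.primeFactors, Finset.prod_singleton]

/-- **`|λ₀ⱼ(q)| ≤ 27/4`** for a prime `q`: the three numerator factors have modulus `≤ 3/2` and the
denominator `≥ 1/2` (all exponents have real part `1`, the shifts being purely imaginary).
[cite: Zhang2022LandauSiegel, §7 p.13] -/
theorem norm_lamZero_prime_le (j : ℕ) {q : ℕ} (hq : q.Prime) :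
    ‖lamZero c' D j q‖ ≤ 27 / 4 := by
  have hq2 : 2 ≤ q := hq.two_le
  have hs : (1 - betaJ c' D j).re = 1 := by simp [betaJ_re]
  have h1 : (1 - betaJ c' D j + beta1 c' D).re = 1 := by simp [betaJ_re, beta1_re]
  have h2 : (1 - betaJ c' D j + beta2 c' D).re = 1 := by simp [betaJ_re, beta2_re]
  have h3 : (1 - betaJ c' D j + beta3 c' D).re = 1 := by simp [betaJ_re, beta3_re]
  rw [lamZero, lam_prime c' D hq, norm_div, norm_mul, norm_mul]
  have hA := norm_one_sub_cpow_le hq2 h1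
  have hB := norm_one_sub_cpow_le hq2 h2
  have hC := norm_one_sub_cpow_le hq2 h3
  have hDn := half_le_norm_one_sub_cpow hq2 hs
  have hDpos : 0 < ‖1 - (q : ℂ) ^ (-(1 - betaJ c' D j))‖ := by linarith
  rw [div_le_iff₀ hDpos]
  have h0A := norm_nonneg (1 - (q : ℂ) ^ (-(1 - betaJ c' D j + beta1 c' D)))
  have h0B := norm_nonneg (1 - (q : ℂ) ^ (-(1 - betaJ c' D j + beta2 c' D)))
  have h0C := norm_nonneg (1 - (q : ℂ) ^ (-(1 - betaJ c' D j + beta3 c' D)))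
  calc ‖1 - (q : ℂ) ^ (-(1 - betaJ c' D j + beta1 c' D))‖ *
        ‖1 - (q : ℂ) ^ (-(1 - betaJ c' D j + beta2 c' D))‖ *
        ‖1 - (q : ℂ) ^ (-(1 - betaJ c' D j + beta3 c' D))‖ ≤ 3 / 2 * (3 / 2) * (3 / 2) := by
        gcongr
    _ = 27 / 4 * (1 / 2) := by norm_num
    _ ≤ 27 / 4 * ‖1 - (q : ℂ) ^ (-(1 - betaJ c' D j))‖ := by gcongr

/-- **`|λ̃₀ⱼ(n,dr)| ≤ n³`** (`n ≥ 1`): each factor is `≤ 27/4 ≤ q³`, and the radical of `n` divides `n`.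
[cite: Zhang2022LandauSiegel, §7 p.13] -/
theorem norm_lamTildeZero_le (j n dr : ℕ) (hn : n ≠ 0) :
    ‖lamTildeZero c' D j n dr‖ ≤ (n : ℝ) ^ 3 := by
  rw [lamTildeZero, norm_prod]
  have hrad : ((∏ q ∈ n.primeFactors, q : ℕ) : ℝ) ≤ n := by
    exact_mod_cast Nat.le_of_dvd (Nat.pos_of_ne_zero hn) (Nat.prod_primeFactors_dvd n)
  calc ∏ q ∈ n.primeFactors.filter (fun q => Nat.Coprime q dr), ‖lamZero c' D j q‖
      ≤ ∏ q ∈ n.primeFactors.filter (fun q => Nat.Coprime q dr), ((q : ℝ) ^ 3) := by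
        refine Finset.prod_le_prod (fun _ _ => norm_nonneg _) fun q hq => ?_
        have hqp : q.Prime := Nat.prime_of_mem_primeFactors (Finset.mem_filter.1 hq).1
        have hq2 : (2 : ℝ) ≤ q := by exact_mod_cast hqp.two_le
        calc ‖lamZero c' D j q‖ ≤ 27 / 4 := norm_lamZero_prime_le c' D j hqp
          _ ≤ 2 ^ 3 := by norm_num
          _ ≤ (q : ℝ) ^ 3 := by gcongr
    _ = ((∏ q ∈ n.primeFactors.filter (fun q => Nat.Coprime q dr), q ^ 3 : ℕ) : ℝ) := by
        push_cast; rfl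
    _ ≤ ((∏ q ∈ n.primeFactors, q ^ 3 : ℕ) : ℝ) := by
        exact_mod_cast Finset.prod_le_prod_of_subset_of_one_le' (Finset.filter_subset _ _)
          fun q hq _ => Nat.one_le_pow _ _ (Nat.prime_of_mem_primeFactors hq).pos
    _ = ((∏ q ∈ n.primeFactors, q : ℕ) : ℝ) ^ 3 := by rw [Finset.prod_pow]; push_cast; rfl
    _ ≤ (n : ℝ) ^ 3 := by gcongr

end Lambda

/-! ### `κ` and `κ̃` -/

section Kappa

variable (c' : ℝ) (D : ℕ)

/-- **`|κ(N)| ≤ τ(N)³`** (`N ≥ 1`): `κ` is multiplicative with `|κ(p^k)| ≤ (k+1)³`.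
[cite: Zhang2022LandauSiegel, §7 p.14] -/
theorem norm_kappaZ_le {N : ℕ} (hN : N ≠ 0) :
    ‖kappaZ c' D N‖ ≤ (N.divisors.card : ℝ) ^ 3 := by
  have hmul := isMultiplicative_kappa (b1 c' D) (b2 c' D) (b3 c' D)
  rw [kappaZ, hmul.multiplicative_factorization _ hN, Finsupp.prod, Nat.support_factorization,
    norm_prod, Nat.card_divisors hN]
  push_cast
  rw [← Finset.prod_pow]
  refine Finset.prod_le_prod (fun _ _ => norm_nonneg _) fun p hp => ?_
  exact norm_kappa_prime_pow_le (b1 c' D) (b2 c' D) (b3 c' D) (Nat.prime_of_mem_primeFactors hp) _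

/-- The divisor bound `τ(n) ≤ C_τ n^{1/6}` with an admissible `C_τ ≥ 1` (Hardy–Wright Thm 315, from
the tree). [cite: HardyWright2008, Theorem 315] -/
theorem exists_Ctau : ∃ C : ℝ, 1 ≤ C ∧ ∀ n : ℕ, n ≠ 0 →
    (n.divisors.card : ℝ) ≤ C * (n : ℝ) ^ (1 / 6 : ℝ) :=
  Literature.NumberTheory.Sieve.exists_card_divisors_le_mul_rpow (by norm_num)

/-- `|κ(N)| ≤ C_τ³ N^{1/2}`. [cite: Zhang2022LandauSiegel, §7 p.14] -/
theorem norm_kappaZ_le_rpow {Ctau : ℝ}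
    (hCtau : ∀ n : ℕ, n ≠ 0 → (n.divisors.card : ℝ) ≤ Ctau * (n : ℝ) ^ (1 / 6 : ℝ)) {N : ℕ} (hN : N ≠ 0) :
    ‖kappaZ c' D N‖ ≤ Ctau ^ 3 * (N : ℝ) ^ (1 / 2 : ℝ) := by
  have hN0 : (0 : ℝ) ≤ N := Nat.cast_nonneg N
  have h := hCtau N hN
  have h3 : (N.divisors.card : ℝ) ^ 3 ≤ (Ctau * (N : ℝ) ^ (1 / 6 : ℝ)) ^ 3 :=
    pow_le_pow_left₀ (Nat.cast_nonneg _) h 3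
  calc ‖kappaZ c' D N‖ ≤ (N.divisors.card : ℝ) ^ 3 := norm_kappaZ_le c' D hN
    _ ≤ (Ctau * (N : ℝ) ^ (1 / 6 : ℝ)) ^ 3 := h3
    _ = Ctau ^ 3 * (N : ℝ) ^ (1 / 2 : ℝ) := by
        rw [mul_pow, ← Real.rpow_natCast ((N : ℝ) ^ (1 / 6 : ℝ)) 3, ← Real.rpow_mul hN0]
        norm_num

/-- `p^{−1/2} ≤ 3/4` for `p ≥ 2`. [folklore] -/
private theorem rpow_neg_half_le {p : ℕ} (hp : 2 ≤ p) : (p : ℝ) ^ (-(1 / 2 : ℝ)) ≤ 3 / 4 := by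
  have hp0 : (0 : ℝ) < p := by exact_mod_cast (by omega : 0 < p)
  have h2 : (p : ℝ) ^ (-(1 / 2 : ℝ)) ≤ (2 : ℝ) ^ (-(1 / 2 : ℝ)) :=
    Real.rpow_le_rpow_of_nonpos (by norm_num) (by exact_mod_cast hp) (by norm_num)
  have hs : (2 : ℝ) ^ (-(1 / 2 : ℝ)) = (Real.sqrt 2)⁻¹ := by
    rw [Real.rpow_neg (by norm_num), Real.sqrt_eq_rpow]
  have hsq : (4 : ℝ) / 3 ≤ Real.sqrt 2 := by
    rw [show (4 : ℝ) / 3 = Real.sqrt ((4 / 3) ^ 2) by rw [Real.sqrt_sq (by norm_num)]]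
    exact Real.sqrt_le_sqrt (by norm_num)
  have h3 : (Real.sqrt 2)⁻¹ ≤ 3 / 4 := by
    rw [inv_eq_one_div, div_le_iff₀ (by positivity)]
    linarith
  linarith [h2.trans (hs.le.trans h3)]

/-- The Euler product over the `d`-factored numbers: `∑_{h ∈ 𝔫(d)} h^{−1/2}` converges, with sum
`∏_{p∣d}(1 − p^{−1/2})⁻¹ ≤ ∏_{p∣d} p² ≤ d²` (as a `HasSum` over `ℕ` of the indicator). [folklore] -/
private theorem hasSum_factored_rpow (d : ℕ) :
    ∃ S : ℝ, S ≤ ((∏ p ∈ d.primeFactors, p : ℕ) : ℝ) ^ 2 ∧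
      HasSum ((Nat.factoredNumbers d.primeFactors).indicator fun h : ℕ => (h : ℝ) ^ (-(1 / 2 : ℝ))) S := by
  let f : ℕ →* ℝ :=
    { toFun := fun n => (n : ℝ) ^ (-(1 / 2 : ℝ))
      map_one' := by simp
      map_mul' := fun m n => by
        push_cast
        exact Real.mul_rpow (Nat.cast_nonneg m) (Nat.cast_nonneg n) }
  have hf : ∀ n : ℕ, f n = (n : ℝ) ^ (-(1 / 2 : ℝ)) := fun n => rfl
  have hlt : ∀ {p : ℕ}, p.Prime → ‖f p‖ < 1 := by
    intro p hp
    rw [hf, Real.norm_eq_abs, abs_of_nonneg (by positivity)]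
    linarith [rpow_neg_half_le hp.two_le]
  obtain ⟨-, hsum⟩ :=
    EulerProduct.summable_and_hasSum_factoredNumbers_prod_filter_prime_geometric hlt d.primeFactors
  refine ⟨_, ?_, (hasSum_subtype_iff_indicator.mp hsum)⟩
  have hfilter : d.primeFactors.filter (fun p => p.Prime) = d.primeFactors :=
    Finset.filter_true_of_mem fun p hp => Nat.prime_of_mem_primeFactors hp
  rw [hfilter]
  push_cast
  rw [← Finset.prod_pow]
  refine Finset.prod_le_prod (fun p hp => ?_) fun p hp => ?_
  · have h34 := rpow_neg_half_le (Nat.prime_of_mem_primeFactors hp).two_le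
    rw [hf, inv_nonneg]; linarith
  · have hpp := Nat.prime_of_mem_primeFactors hp
    have h34 := rpow_neg_half_le hpp.two_le
    have hp2 : (2 : ℝ) ≤ p := by exact_mod_cast hpp.two_le
    rw [hf]
    calc (1 - (p : ℝ) ^ (-(1 / 2 : ℝ)))⁻¹ ≤ (1 / 4)⁻¹ := by
          apply inv_anti₀ (by norm_num); linarith
      _ = 2 ^ 2 := by norm_num
      _ ≤ (p : ℝ) ^ 2 := by gcongr

/-- `𝔫(d) ⊆` the `d`-factored numbers (`d ≥ 1`). [cite: Zhang2022LandauSiegel, §7 p.13] -/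
theorem mem_factoredNumbers_of_mem_nset {d h : ℕ} (hd : d ≠ 0) (hh : h ∈ nset d) :
    h ∈ Nat.factoredNumbers d.primeFactors := by
  rw [Nat.mem_factoredNumbers']
  intro p hp hph
  exact Nat.mem_primeFactors.2 ⟨hp, hh.2 p hp hph, hd⟩

/-- **`|κ̃(d;m,s)| ≤ C_τ³ d³`** for `Re s = 1`, `d ≥ 1` (any `m`): the series over `h ∈ 𝔫(d)`,
`(h,m) = 1` is majorised termwise by `C_τ³ d^{1/2} h^{−1/2}` on the `d`-factored numbers
(`|κ(dh)| ≤ C_τ³(dh)^{1/2}`), whose sum is `≤ C_τ³ d^{1/2}·d²`; a non-summable series has `tsum = 0`.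
[cite: Zhang2022LandauSiegel, §7 p.13] -/
theorem norm_kappaTilde_le {Ctau : ℝ} (hC1 : 1 ≤ Ctau)
    (hCtau : ∀ n : ℕ, n ≠ 0 → (n.divisors.card : ℝ) ≤ Ctau * (n : ℝ) ^ (1 / 6 : ℝ))
    {d : ℕ} (hd : 1 ≤ d) (m : ℕ) {s : ℂ} (hs : s.re = 1) :
    ‖kappaTilde c' D d m s‖ ≤ Ctau ^ 3 * (d : ℝ) ^ 3 := by
  classical
  have hd0 : d ≠ 0 := by omega
  have hdR : (1 : ℝ) ≤ d := by exact_mod_cast hd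
  have hC : 0 ≤ Ctau ^ 3 := pow_nonneg (zero_le_one.trans hC1) 3
  obtain ⟨S, hS, hsum⟩ := hasSum_factored_rpow d
  set g : ℕ → ℝ := fun h => Ctau ^ 3 * (d : ℝ) ^ (1 / 2 : ℝ) *
    (Nat.factoredNumbers d.primeFactors).indicator (fun h : ℕ => (h : ℝ) ^ (-(1 / 2 : ℝ))) h with hg
  have hgsum : HasSum g (Ctau ^ 3 * (d : ℝ) ^ (1 / 2 : ℝ) * S) := hsum.mul_left _
  have hbound : ∀ h : ℕ, ‖(if h ∈ nset d ∧ Nat.Coprime h m then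
      kappaZ c' D (d * h) / (h : ℂ) ^ s else 0)‖ ≤ g h := by
    intro h
    by_cases hc : h ∈ nset d ∧ Nat.Coprime h m
    · rw [if_pos hc]
      have hh0 : 0 < h := hc.1.1
      have hhR : (0 : ℝ) < h := by exact_mod_cast hh0
      have hmem := mem_factoredNumbers_of_mem_nset hd0 hc.1
      rw [hg]
      simp only [Set.indicator_of_mem hmem]
      rw [norm_div, Complex.norm_natCast_cpow_of_pos hh0, hs, Real.rpow_one]
      have hκ := norm_kappaZ_le_rpow c' D hCtau (mul_ne_zero hd0 hh0.ne')
      rw [div_le_iff₀ hhR]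
      calc ‖kappaZ c' D (d * h)‖ ≤ Ctau ^ 3 * ((d * h : ℕ) : ℝ) ^ (1 / 2 : ℝ) := hκ
        _ = Ctau ^ 3 * (d : ℝ) ^ (1 / 2 : ℝ) * ((h : ℝ) ^ (-(1 / 2 : ℝ)) * h) := by
            push_cast
            rw [Real.mul_rpow (Nat.cast_nonneg d) hhR.le]
            have : (h : ℝ) ^ (-(1 / 2 : ℝ)) * h = (h : ℝ) ^ (1 / 2 : ℝ) := by
              conv_lhs => rw [show (h : ℝ) ^ (-(1 / 2 : ℝ)) * h =
                (h : ℝ) ^ (-(1 / 2 : ℝ)) * (h : ℝ) ^ (1 : ℝ) by rw [Real.rpow_one]]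
              rw [← Real.rpow_add hhR]; norm_num
            rw [this]; ring
        _ = Ctau ^ 3 * (d : ℝ) ^ (1 / 2 : ℝ) * (h : ℝ) ^ (-(1 / 2 : ℝ)) * h := by ring
    · rw [if_neg hc, norm_zero, hg]
      exact mul_nonneg (by positivity) (Set.indicator_nonneg (fun _ _ => by positivity) _)
  have key := tsum_of_norm_bounded hgsum hbound
  rw [kappaTilde]
  refine key.trans ?_
  have hrad : ((∏ p ∈ d.primeFactors, p : ℕ) : ℝ) ≤ d := by
    exact_mod_cast Nat.le_of_dvd (by omega) (Nat.prod_primeFactors_dvd d)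
  have hS' : S ≤ (d : ℝ) ^ 2 := hS.trans (by gcongr)
  have hd12 : (d : ℝ) ^ (1 / 2 : ℝ) ≤ d := by
    calc (d : ℝ) ^ (1 / 2 : ℝ) ≤ (d : ℝ) ^ (1 : ℝ) :=
          Real.rpow_le_rpow_of_exponent_le hdR (by norm_num)
      _ = d := Real.rpow_one _
  have hS0 : 0 ≤ S := by
    refine hsum.nonneg fun h => Set.indicator_nonneg (fun _ _ => by positivity) _
  calc Ctau ^ 3 * (d : ℝ) ^ (1 / 2 : ℝ) * S ≤ Ctau ^ 3 * d * (d : ℝ) ^ 2 := by gcongr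
    _ = Ctau ^ 3 * (d : ℝ) ^ 3 := by ring

end Kappa

/-! ### `ξ₀ⱼ(n;d,r)` and the Dirichlet series of Lemma 8.4 -/

section Xi

variable (c' : ℝ) (D : ℕ)

/-- **`|ξ₀ⱼ(n;d,r)| ≤ C_τ³ n⁸`** (`n ≥ 1`; any `d, r`). [cite: Zhang2022LandauSiegel, §7 p.13] -/
theorem norm_xiZero_le {Ctau : ℝ} (hC1 : 1 ≤ Ctau)
    (hCtau : ∀ n : ℕ, n ≠ 0 → (n.divisors.card : ℝ) ≤ Ctau * (n : ℝ) ^ (1 / 6 : ℝ))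
    (j : ℕ) {n : ℕ} (d r : ℕ) (hn : 1 ≤ n) :
    ‖xiZero c' D j n d r‖ ≤ Ctau ^ 3 * (n : ℝ) ^ 8 := by
  have hn0 : n ≠ 0 := by omega
  have hnR : (1 : ℝ) ≤ n := by exact_mod_cast hn
  have hC : 0 ≤ Ctau ^ 3 := pow_nonneg (zero_le_one.trans hC1) 3
  rw [xiZero, norm_mul]
  have hlam := norm_lamTildeZero_le c' D j n (d * r) hn0
  -- the `k`-sum
  have hk : ‖∑ k ∈ n.divisors.filter (fun k => Nat.Coprime k r),
      kappaTildeZero c' D j (n / k) (d * r * k) * (ArithmeticFunction.moebius k : ℂ) *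
        (k : ℂ) ^ (1 - betaJ c' D j) / (Nat.totient k : ℂ)‖ ≤ Ctau ^ 3 * (n : ℝ) ^ 5 := by
    refine (norm_sum_le _ _).trans ?_
    have hterm : ∀ k ∈ n.divisors.filter (fun k => Nat.Coprime k r),
        ‖kappaTildeZero c' D j (n / k) (d * r * k) * (ArithmeticFunction.moebius k : ℂ) *
          (k : ℂ) ^ (1 - betaJ c' D j) / (Nat.totient k : ℂ)‖ ≤ Ctau ^ 3 * (n : ℝ) ^ 4 := by
      intro k hk
      have hkd : k ∈ n.divisors := (Finset.mem_filter.1 hk).1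
      have hk0 : 0 < k := Nat.pos_of_mem_divisors hkd
      have hkn : k ≤ n := Nat.divisor_le hkd
      have hknR : (k : ℝ) ≤ n := by exact_mod_cast hkn
      have hdvd : k ∣ n := Nat.dvd_of_mem_divisors hkd
      have hnk1 : 1 ≤ n / k := Nat.div_pos hkn hk0
      have hnkn : ((n / k : ℕ) : ℝ) ≤ n := by exact_mod_cast Nat.div_le_self n k
      have hre : (1 - betaJ c' D j).re = 1 := by simp [betaJ_re]
      have hκ := norm_kappaTilde_le c' D hC1 hCtau hnk1 (d * r * k) hre
      have hμ : ‖(ArithmeticFunction.moebius k : ℂ)‖ ≤ 1 := by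
        rw [Complex.norm_intCast]
        exact_mod_cast ArithmeticFunction.abs_moebius_le_one
      have hkpow : ‖(k : ℂ) ^ (1 - betaJ c' D j)‖ = k := by
        rw [Complex.norm_natCast_cpow_of_pos hk0, hre, Real.rpow_one]
      have hφ : (1 : ℝ) ≤ ‖(Nat.totient k : ℂ)‖ := by
        rw [Complex.norm_natCast]; exact_mod_cast Nat.totient_pos.2 hk0
      rw [norm_div, norm_mul, norm_mul, hkpow, kappaTildeZero]
      rw [div_le_iff₀ (by linarith)]
      calc ‖kappaTilde c' D (n / k) (d * r * k) (1 - betaJ c' D j)‖ *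
            ‖(ArithmeticFunction.moebius k : ℂ)‖ * k
          ≤ Ctau ^ 3 * ((n / k : ℕ) : ℝ) ^ 3 * 1 * n := by gcongr
        _ ≤ Ctau ^ 3 * (n : ℝ) ^ 3 * 1 * n := by gcongr
        _ = Ctau ^ 3 * (n : ℝ) ^ 4 * 1 := by ring
        _ ≤ Ctau ^ 3 * (n : ℝ) ^ 4 * ‖(Nat.totient k : ℂ)‖ := by gcongr
    refine (Finset.sum_le_sum hterm).trans ?_
    rw [Finset.sum_const, nsmul_eq_mul]
    have hcard : ((n.divisors.filter (fun k => Nat.Coprime k r)).card : ℝ) ≤ n := by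
      calc ((n.divisors.filter (fun k => Nat.Coprime k r)).card : ℝ) ≤ (n.divisors.card : ℝ) := by
            exact_mod_cast Finset.card_filter_le _ _
        _ ≤ n := by exact_mod_cast Nat.card_divisors_le_self n
    calc ((n.divisors.filter (fun k => Nat.Coprime k r)).card : ℝ) * (Ctau ^ 3 * (n : ℝ) ^ 4)
        ≤ n * (Ctau ^ 3 * (n : ℝ) ^ 4) := by gcongr
      _ = Ctau ^ 3 * (n : ℝ) ^ 5 := by ring
  calc ‖lamTildeZero c' D j n (d * r)‖ * _ ≤ (n : ℝ) ^ 3 * (Ctau ^ 3 * (n : ℝ) ^ 5) :=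
        mul_le_mul hlam hk (norm_nonneg _) (by positivity)
    _ = Ctau ^ 3 * (n : ℝ) ^ 8 := by ring

variable {D} (χ : DirichletCharacter ℂ D)

/-- The coefficients of the Dirichlet series behind (8.9) are `a(n) = χ(n)ξ₀ⱼ(n;d,r)n^{β_μ−1}` (so that
`χ(n)ξ₀ⱼ(n;d,r)n⁻¹(x/n)^{−β_μ} = x^{−β_μ}a(n)`); **`|a(n)| ≤ C_τ³ n⁷`** (`n ≥ 1`).
[cite: Zhang2022LandauSiegel, §8 (8.9)] -/
theorem norm_coeff_le {Ctau : ℝ} (hC1 : 1 ≤ Ctau)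
    (hCtau : ∀ n : ℕ, n ≠ 0 → (n.divisors.card : ℝ) ≤ Ctau * (n : ℝ) ^ (1 / 6 : ℝ))
    (j μ d r : ℕ) {n : ℕ} (hn : n ≠ 0) :
    ‖χ (n : ZMod D) * xiZero c' D j n d r * (n : ℂ) ^ (betaMu D μ - 1)‖ ≤
      Ctau ^ 3 * (n : ℝ) ^ (7 : ℝ) := by
  have hn1 : 1 ≤ n := Nat.one_le_iff_ne_zero.2 hn
  have hn0 : 0 < n := by omega
  have hnR : (0 : ℝ) < n := by exact_mod_cast hn0
  have hC : 0 ≤ Ctau ^ 3 := pow_nonneg (zero_le_one.trans hC1) 3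
  rw [norm_mul, norm_mul, Complex.norm_natCast_cpow_of_pos hn0, sub_re, betaMu_re,
    one_re, zero_sub, Real.rpow_neg_one]
  have hχ := χ.norm_le_one (n : ZMod D)
  have hξ := norm_xiZero_le c' D hC1 hCtau j d r hn1
  calc ‖χ (n : ZMod D)‖ * ‖xiZero c' D j n d r‖ * (n : ℝ)⁻¹
      ≤ 1 * (Ctau ^ 3 * (n : ℝ) ^ 8) * (n : ℝ)⁻¹ := by gcongr
    _ = Ctau ^ 3 * (n : ℝ) ^ (7 : ℝ) := by
        rw [show (7 : ℝ) = ((7 : ℕ) : ℝ) by norm_num, Real.rpow_natCast]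
        field_simp

/-- **Absolute convergence**: `∑ a(n)n^{−u}` converges absolutely for `Re u > 8`.
[cite: Zhang2022LandauSiegel, §8 (8.9)] -/
theorem LSeriesSummable_coeff (j μ d r : ℕ) {u : ℂ} (hu : 8 < u.re) :
    LSeriesSummable (fun n : ℕ => χ (n : ZMod D) * xiZero c' D j n d r * (n : ℂ) ^ (betaMu D μ - 1)) u := by
  obtain ⟨Ctau, hC1, hCtau⟩ := exists_Ctau
  refine LSeriesSummable_of_le_const_mul_rpow (x := 8) hu ⟨Ctau ^ 3, fun n hn => ?_⟩
  have := norm_coeff_le c' χ hC1 hCtau j μ d r hn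
  norm_num at this ⊢
  exact this

/-- **The Dirichlet series is the manuscript's `∑_n χ(n)ξ₀ⱼ(n;d,r)n^{−s}` at `s = 1 − β_μ + u`**
(the skeleton's `xiSeries`), for `Re u > 8`. [cite: Zhang2022LandauSiegel, §8 Lemma 8.3, (8.9)] -/
theorem LSeries_coeff_eq_xiSeries (j μ d r : ℕ) {u : ℂ} (hu : 8 < u.re) :
    LSeries (fun n : ℕ => χ (n : ZMod D) * xiZero c' D j n d r * (n : ℂ) ^ (betaMu D μ - 1)) u =
      xiSeries c' χ j d r (1 - betaMu D μ + u) := by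
  rw [LSeries, xiSeries]
  refine tsum_congr fun n => ?_
  rcases Nat.eq_zero_or_pos n with rfl | hn
  · have hne : -(1 - betaMu D μ + u) ≠ 0 := by
      intro h
      have := congrArg Complex.re h
      simp [betaMu_re] at this
      linarith
    have hz : (0 : ℂ) ^ (-(1 - betaMu D μ + u)) = 0 := Complex.zero_cpow hne
    simp only [LSeries.term_zero, Nat.cast_zero, hz, mul_zero]
  · have hn0 : (n : ℂ) ≠ 0 := by exact_mod_cast hn.ne'
    rw [LSeries.term_of_ne_zero hn.ne']
    have e : (n : ℂ) ^ (betaMu D μ - 1) / (n : ℂ) ^ u = (n : ℂ) ^ (-(1 - betaMu D μ + u)) := by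
      rw [← Complex.cpow_sub _ _ hn0]; congr 1; ring
    calc χ (n : ZMod D) * xiZero c' D j n d r * (n : ℂ) ^ (betaMu D μ - 1) / (n : ℂ) ^ u
        = χ (n : ZMod D) * xiZero c' D j n d r * ((n : ℂ) ^ (betaMu D μ - 1) / (n : ℂ) ^ u) := by
          ring
      _ = _ := by rw [e]

/-- The printed summand against the coefficient: for `n ≥ 1`, `x > 0`,
`χ(n)ξ₀ⱼ(n;d,r)n⁻¹(x/n)^{−β_μ}log(x/n) = e^{−β_μ log x}·a(n)log(x/n)`.
[cite: Zhang2022LandauSiegel, §8 Lemma 8.4] -/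
theorem summand_eq (j μ d r : ℕ) {y : ℝ} (hy : 0 < y) {n : ℕ} (hn : n ≠ 0) :
    χ (n : ZMod D) * xiZero c' D j n d r / (n : ℂ) * ((y / n : ℝ) : ℂ) ^ (-betaMu D μ) *
        (Real.log (y / n) : ℂ) =
      cexp (-(betaMu D μ * (Real.log y : ℂ))) *
        ((χ (n : ZMod D) * xiZero c' D j n d r * (n : ℂ) ^ (betaMu D μ - 1)) *
          (Real.log (y / n) : ℂ)) := by
  have hn0 : (0 : ℝ) < n := by exact_mod_cast Nat.pos_of_ne_zero hn
  have hnC : (n : ℂ) ≠ 0 := by exact_mod_cast hn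
  have hyn : (0 : ℝ) < y / n := div_pos hy hn0
  have hynC : (((y / n : ℝ)) : ℂ) ≠ 0 := by exact_mod_cast hyn.ne'
  rw [Complex.cpow_def_of_ne_zero hnC, Complex.cpow_def_of_ne_zero hynC,
    ← Complex.ofReal_log hyn.le, ← Complex.natCast_log, Real.log_div hy.ne' hn0.ne']
  have e : cexp (((Real.log y - Real.log n : ℝ) : ℂ) * -betaMu D μ) / (n : ℂ) =
      cexp (-(betaMu D μ * (Real.log y : ℂ))) * cexp ((Real.log n : ℂ) * (betaMu D μ - 1)) := by
    rw [div_eq_mul_inv, show ((n : ℂ))⁻¹ = cexp (-(Real.log n : ℂ)) by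
      rw [Complex.exp_neg, Complex.natCast_log, Complex.exp_log hnC],
      ← Complex.exp_add, ← Complex.exp_add]
    congr 1; push_cast; ring
  calc χ (n : ZMod D) * xiZero c' D j n d r / (n : ℂ) *
        cexp (((Real.log y - Real.log n : ℝ) : ℂ) * -betaMu D μ) *
        ((Real.log y - Real.log n : ℝ) : ℂ)
      = χ (n : ZMod D) * xiZero c' D j n d r *
          (cexp (((Real.log y - Real.log n : ℝ) : ℂ) * -betaMu D μ) / (n : ℂ)) *
          ((Real.log y - Real.log n : ℝ) : ℂ) := by ring
    _ = _ := by rw [e]; ring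

/-- `‖e^{−β_μ log x}‖ = 1`. [cite: Zhang2022LandauSiegel, §2 (2.22)] -/
theorem norm_cexp_neg_betaMu_mul (μ : ℕ) (L : ℝ) : ‖cexp (-(betaMu D μ * (L : ℂ)))‖ = 1 := by
  rw [Complex.norm_exp]
  simp [Complex.mul_re, betaMu_re, betaMu_im]

/-- The sum over `n < x` (`Finset.Ico 1 ⌈x⌉`) equals the sum over `n ≤ x` (`Finset.Ioc 0 ⌊x⌋`): the
term `n = x`, if any, carries `log(x/n) = 0`. [cite: Zhang2022LandauSiegel, §8 Lemma 8.4] -/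
theorem sum_Ico_eq_sum_Ioc (g : ℕ → ℂ) {y : ℝ} (hy : 0 < y) :
    ∑ n ∈ Finset.Ico 1 ⌈y⌉₊, g n * (Real.log (y / n) : ℂ) =
      ∑ n ∈ Finset.Ioc 0 ⌊y⌋₊, g n * (Real.log (y / n) : ℂ) := by
  have hsub : Finset.Ico 1 ⌈y⌉₊ ⊆ Finset.Ioc 0 ⌊y⌋₊ := by
    intro m hm
    rw [Finset.mem_Ico] at hm
    rw [Finset.mem_Ioc]
    exact ⟨hm.1, Nat.le_floor (Nat.lt_ceil.mp hm.2).le⟩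
  apply Finset.sum_subset hsub
  intro m hm hm'
  rw [Finset.mem_Ioc] at hm
  rw [Finset.mem_Ico, not_and, not_lt] at hm'
  have hym : y ≤ m := Nat.ceil_le.mp (hm' hm.1)
  have hmy : (m : ℝ) ≤ y := (Nat.le_floor_iff hy.le).mp hm.2
  have hm_eq : (m : ℝ) = y := le_antisymm hmy hym
  have hlog : Real.log (y / m) = 0 := by rw [hm_eq, div_self hy.ne', Real.log_one]
  simp [hlog]

/-- **The printed sum as `x^{−β_μ}` times a logarithmic Riesz mean of the coefficients.**
[cite: Zhang2022LandauSiegel, §8 Lemma 8.4] -/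
theorem printedSum_eq (j μ d r : ℕ) {y : ℝ} (hy : 0 < y) :
    (∑ n ∈ Finset.Ico 1 ⌈y⌉₊, χ (n : ZMod D) * xiZero c' D j n d r / (n : ℂ) *
        ((y / n : ℝ) : ℂ) ^ (-betaMu D μ) * (Real.log (y / n) : ℂ)) =
      cexp (-(betaMu D μ * (Real.log y : ℂ))) *
        ∑ n ∈ Finset.Ioc 0 ⌊y⌋₊, (χ (n : ZMod D) * xiZero c' D j n d r * (n : ℂ) ^ (betaMu D μ - 1)) *
          (Real.log (y / n) : ℂ) := by
  have h1 : (∑ n ∈ Finset.Ico 1 ⌈y⌉₊, χ (n : ZMod D) * xiZero c' D j n d r / (n : ℂ) *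
        ((y / n : ℝ) : ℂ) ^ (-betaMu D μ) * (Real.log (y / n) : ℂ)) =
      ∑ n ∈ Finset.Ico 1 ⌈y⌉₊, (cexp (-(betaMu D μ * (Real.log y : ℂ))) *
        (χ (n : ZMod D) * xiZero c' D j n d r * (n : ℂ) ^ (betaMu D μ - 1))) *
        (Real.log (y / n) : ℂ) := by
    refine Finset.sum_congr rfl fun n hn => ?_
    have hn0 : n ≠ 0 := Nat.one_le_iff_ne_zero.1 (Finset.mem_Ico.1 hn).1
    rw [summand_eq c' χ j μ d r hy hn0]; ring
  rw [h1, sum_Ico_eq_sum_Ioc _ hy, Finset.mul_sum]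
  refine Finset.sum_congr rfl fun n _ => ?_
  ring

end Xi

end Literature.NumberTheory.LFunctions.Zhang2022.Lemma84
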